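import Mathlib
import Summits.HodgeConjecture.HodgeConjecture.Theorems.WeilClassTestFormatFiveThreeCrossPlusTwoPieceDefsEF
import Summits.HodgeConjecture.HodgeConjecture.Theorems.WeilClassTestFormatFiveThreeCrossPlusTwoPieceDefsEFB1
import Summits.HodgeConjecture.HodgeConjecture.Theorems.WeilClassTestFormatFiveThreeCrossPlusTwoPieceExitsEF
import Summits.HodgeConjecture.HodgeConjecture.Theorems.WeilClassTestFormatFiveThreeCrossPlusTwoPieceMapEFB1C
import Summits.HodgeConjecture.HodgeConjecture.Theorems.WeilClassTestFormatFiveThreeCrossPlusTwoFaceWEF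
import Summits.HodgeConjecture.HodgeConjecture.Theorems.WeilClassTestFormatFiveThreeCrossPlusTwoFaceWEFSlices
import Summits.HodgeConjecture.HodgeConjecture.Theorems.WeilClassTestFormatFiveThreeCrossPlusOneEndpoint

/-!
# Conjecture N (hodge-weil ladder, GAPS G51b), format (5,3): CROSS + ONE FREE E-ROOT + ONE FREE F-ROOT — THE k = 2 EF PIECE ASSEMBLED MODULO ITS LAST EXIT (L-H)

Prover 2, generation 32 (note `run/shared/lean/b2b/hodge-weil/b2b-hweil-pv2-g32/PIECE-FF-G32.md`). The EF analogue of `…PieceFFOfExitH` (this generation) and of pv2-g28's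
`…CrossPlusTwoPiece.piece_EE_nonneg`, with the ONE exit that has no certificate yet — (L-H), `H = 0`, the double corner DC(EF) — carried as an explicit hypothesis `hExitH`
(universally quantified over the piece data; no named fact, no definition). Charge-gap coordinates `(m,t,a1,a2,u1,u2)` of the EF piece (`b1 = a1 − t + u1` for the E-root,
`b2 = a2 + t − u2` for the F-root; `pW, pQ0, pH, pN` of `…PieceDefsEF`, `pB1` of `…PieceDefsEFB1`). Hypotheses of the EF piece (pv2-g29 `EE-REDUCED-G29.md` A.4): `m > 0`, `a_i ≥ 0`,
`b_i ≥ 0`, `W > 0`, `Q0 ≥ 0`, `H ≤ 0` (`h_m ≥ 0`), **`pB1 ≥ 0`** (the V-side Hankel condition `B1 ≥ 0`, `…PieceMapEFB1.piece_B1`). `N` is a concave quadratic in `t` (`pN_quadratic`);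
window `p(s) = (a1 + u1 − s)·(s − (u2 − a2))` (both `b_i ≥ 0`, so no (L-∞) exit); constraint `q(s) = min(W, Q0, −H, pB1)`. Boundary cases: `b1 = 0` / `b2 = 0` (`exit_b1_EF` /
`exit_b2_EF`), `W = 0` (`exit_W_EF`), `Q0 = 0` (`exit_Q0_EF`, via `…FaceVEF`), `H = 0` (`hExitH`), and **`pB1 = 0`, which is NOT a new face**: by `piece_point_EF` it gives `B1∘Φ = 0`, so
`h_m∘Φ = M1·B1∘Φ − E1² = −E1² ≥ 0` forces `h_m∘Φ = 0`, i.e. `H = 0` — the double corner again (`hExitH`).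

* `piece_EF_nonneg_of_exitH`: (∀ piece points with `W > 0`, `pB1 ≥ 0`, `H = 0`: `N ≥ 0`) ⟹ for every EF piece point: **`N ≥ 0`**.

So the EF piece of real Conjecture N (5,3), k = 2 is CLOSED MODULO DC(EF) (exactly as the FF piece is closed modulo DC(FF) by `…PieceFFOfExitH`). Computational lane through `exit_Q0_EF`
(pv2-g32's EF certificate). Nothing here is a case of HC, a rung or a door edge; no statement of Markman's papers is used. New cell result ⇒ Summits/.
-/

set_option linter.dupNamespace false
set_option maxRecDepth 16384

namespace Summit.HodgeConjecture.HodgeConjecture.WeilClassTestFormatFiveThreeCrossPlusTwoPieceEFOfExitH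

open Summit.HodgeConjecture.HodgeConjecture.WeilClassTestFormatFiveThreeCrossPlusTwoPieceDefsEF
open Summit.HodgeConjecture.HodgeConjecture.WeilClassTestFormatFiveThreeCrossPlusTwoPieceDefsEFB1
open Summit.HodgeConjecture.HodgeConjecture.WeilClassTestFormatFiveThreeCrossPlusTwoPieceExitsEF (piece_point_EF exit_b1_EF exit_b2_EF exit_W_EF exit_Q0_EF)
open Summit.HodgeConjecture.HodgeConjecture.WeilClassTestFormatFiveThreeCrossPlusTwoPieceMapEFB1C (pB1_split)
open Summit.HodgeConjecture.HodgeConjecture.WeilClassTestFormatFiveThreeCrossPlusTwoFaceWEFSlices (pH_tpoly)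
open Summit.HodgeConjecture.HodgeConjecture.WeilClassTestFormatFiveThreeCrossPlusOneEndpoint (endpoint_principle)

set_option maxHeartbeats 4000000 in
/-- **`pB1 = 0` is the double corner.** At an EF piece point with `W > 0` and `pB1 = 0`: `H = 0` (since `B1∘Φ = 0` and `h_m∘Φ = M1·B1∘Φ − E1² ≥ 0`). -/
theorem H_eq_zero_of_pB1_eq_zero (m t a1 a2 u1 u2 : ℝ) (hm : (0:ℝ) < m) (ha1 : (0:ℝ) ≤ a1) (ha2 : (0:ℝ) ≤ a2)
    (hW : (0:ℝ) < pW m t a1 a2) (hQ : (0:ℝ) ≤ pQ0 m t a1 a2 u1 u2) (hH : pH m t a1 a2 u1 u2 ≤ (0:ℝ)) (hB0 : pB1 m t a1 a2 u1 u2 = 0) :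
    pH m t a1 a2 u1 u2 = 0 := by
  have hX : (0:ℝ) < m + a1 + a2 := by linarith
  obtain ⟨M1, E1, hM, hM1, hK, hhp, hC1, hhm, hsq, hG, hhmH, hB1e⟩ := piece_point_EF m t a1 a2 u1 u2 hm ha1 ha2 hW hQ hH
  have hXW3 : (m + a1 + a2) * (pW m t a1 a2)^(3:ℕ) ≠ 0 := mul_ne_zero hX.ne' (pow_ne_zero 3 hW.ne')
  rw [hB0] at hB1e
  have hB1z := (mul_eq_zero.mp hB1e).resolve_left hXW3
  rw [hsq, hB1z, mul_zero, zero_sub] at hhm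
  have hE1 : E1 = 0 := by
    have hsqle : E1^(2:ℕ) ≤ 0 := by linarith
    exact pow_eq_zero_iff two_ne_zero |>.mp (le_antisymm hsqle (sq_nonneg E1))
  rw [hsq, hB1z, hE1] at hhmH
  have h0 : -(pH m t a1 a2 u1 u2) = 0 := by rw [← hhmH]; ring
  linarith

set_option maxHeartbeats 4000000 in
/-- **THE k = 2 EF PIECE OF REAL CONJECTURE N IN FORMAT (5,3), MODULO ITS EXIT (L-H).** If the double-corner exit holds (`hExitH`: at every feasible EF piece point with
`W > 0`, `pB1 ≥ 0` and `H = 0`, `N ≥ 0`), then on the whole EF piece: `m > 0`, `a_i ≥ 0`, `b1 = a1 − t + u1 ≥ 0`, `b2 = a2 + t − u2 ≥ 0`, `W > 0`, `Q0 ≥ 0`, `H ≤ 0`, `pB1 ≥ 0` ⟹ `N ≥ 0`. -/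
theorem piece_EF_nonneg_of_exitH
    (hExitH : ∀ m t a1 a2 u1 u2 : ℝ, (0:ℝ) < m → (0:ℝ) ≤ a1 → (0:ℝ) ≤ a2 → (0:ℝ) ≤ a1 - t + u1 → (0:ℝ) ≤ a2 + t - u2 →
      (0:ℝ) < pW m t a1 a2 → (0:ℝ) ≤ pQ0 m t a1 a2 u1 u2 → pH m t a1 a2 u1 u2 ≤ (0:ℝ) → (0:ℝ) ≤ pB1 m t a1 a2 u1 u2 → pH m t a1 a2 u1 u2 = 0 → (0:ℝ) ≤ pN m t a1 a2 u1 u2)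
    (m t a1 a2 u1 u2 : ℝ) (hm : (0:ℝ) < m) (ha1 : (0:ℝ) ≤ a1) (ha2 : (0:ℝ) ≤ a2)
    (hb1 : (0:ℝ) ≤ a1 - t + u1) (hb2 : (0:ℝ) ≤ a2 + t - u2)
    (hW : (0:ℝ) < pW m t a1 a2) (hQ : (0:ℝ) ≤ pQ0 m t a1 a2 u1 u2) (hH : pH m t a1 a2 u1 u2 ≤ (0:ℝ)) (hB : (0:ℝ) ≤ pB1 m t a1 a2 u1 u2) :
    (0:ℝ) ≤ pN m t a1 a2 u1 u2 := by
  -- the window [u2 − a2, a1 + u1] contains t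
  have hwin : u2 - a2 ≤ a1 + u1 := by linarith
  have hP : ∀ s : ℝ, (fun s : ℝ => (a1 + u1 - s) * (s - (u2 - a2))) s = 0 → (0:ℝ) ≤ (fun s : ℝ => min (pW m s a1 a2) (min (pQ0 m s a1 a2 u1 u2) (min (-(pH m s a1 a2 u1 u2)) (pB1 m s a1 a2 u1 u2)))) s →
      (0:ℝ) ≤ (fun s : ℝ => pN m s a1 a2 u1 u2) s := by
    intro s hps hqs
    change (a1 + u1 - s) * (s - (u2 - a2)) = 0 at hps
    change (0:ℝ) ≤ min (pW m s a1 a2) (min (pQ0 m s a1 a2 u1 u2) (min (-(pH m s a1 a2 u1 u2)) (pB1 m s a1 a2 u1 u2))) at hqs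
    change (0:ℝ) ≤ pN m s a1 a2 u1 u2
    simp only [le_min_iff] at hqs
    obtain ⟨hWs, hQs, hHs, hBs⟩ := hqs
    have hHs' : pH m s a1 a2 u1 u2 ≤ 0 := by linarith
    rcases mul_eq_zero.mp hps with h1 | h2
    · -- b1 = 0 at s = a1 + u1 (then b2(s) ≥ 0 from the window)
      have hb1s : (0:ℝ) ≤ a1 - s + u1 := by linarith
      have hb2s : (0:ℝ) ≤ a2 + s - u2 := by linarith
      rcases hWs.eq_or_lt with hW0 | hWp
      · exact exit_W_EF m s a1 a2 u1 u2 hm ha1 ha2 hb1s hb2s hW0.symm hQs hHs'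
      · exact exit_b1_EF m s a1 a2 u1 u2 hm ha1 ha2 hb1s hb2s hWp hQs hHs' hBs (by linarith)
    · -- b2 = 0 at s = u2 − a2
      have hb1s : (0:ℝ) ≤ a1 - s + u1 := by linarith
      have hb2s : (0:ℝ) ≤ a2 + s - u2 := by linarith
      rcases hWs.eq_or_lt with hW0 | hWp
      · exact exit_W_EF m s a1 a2 u1 u2 hm ha1 ha2 hb1s hb2s hW0.symm hQs hHs'
      · exact exit_b2_EF m s a1 a2 u1 u2 hm ha1 ha2 hb1s hb2s hWp hQs hHs' hBs (by linarith)
  have hQ' : ∀ s : ℝ, (fun s : ℝ => min (pW m s a1 a2) (min (pQ0 m s a1 a2 u1 u2) (min (-(pH m s a1 a2 u1 u2)) (pB1 m s a1 a2 u1 u2)))) s = 0 → (0:ℝ) ≤ (fun s : ℝ => (a1 + u1 - s) * (s - (u2 - a2))) s →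
      (0:ℝ) ≤ (fun s : ℝ => pN m s a1 a2 u1 u2) s := by
    intro s hqs hps
    change min (pW m s a1 a2) (min (pQ0 m s a1 a2 u1 u2) (min (-(pH m s a1 a2 u1 u2)) (pB1 m s a1 a2 u1 u2))) = 0 at hqs
    change (0:ℝ) ≤ (a1 + u1 - s) * (s - (u2 - a2)) at hps
    change (0:ℝ) ≤ pN m s a1 a2 u1 u2
    have hall : (0:ℝ) ≤ min (pW m s a1 a2) (min (pQ0 m s a1 a2 u1 u2) (min (-(pH m s a1 a2 u1 u2)) (pB1 m s a1 a2 u1 u2))) := le_of_eq hqs.symm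
    simp only [le_min_iff] at hall
    obtain ⟨hWs, hQs, hHs, hBs⟩ := hall
    have hHs' : pH m s a1 a2 u1 u2 ≤ 0 := by linarith
    -- from p(s) ≥ 0 and the window: b1(s), b2(s) ≥ 0
    have hb2s : (0:ℝ) ≤ a2 + s - u2 := by
      rcases lt_or_ge (a2 + s - u2) 0 with hneg | hok
      · have hf1 : (0:ℝ) < a1 + u1 - s := by linarith
        have hlt : (a1 + u1 - s) * (s - (u2 - a2)) < 0 := mul_neg_of_pos_of_neg hf1 (by linarith)
        linarith
      · exact hok
    have hb1s : (0:ℝ) ≤ a1 - s + u1 := by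
      rcases lt_or_ge (a1 - s + u1) 0 with hneg | hok
      · have hf2 : (0:ℝ) < s - (u2 - a2) := by linarith
        have hlt : (a1 + u1 - s) * (s - (u2 - a2)) < 0 := mul_neg_of_neg_of_pos (by linarith) hf2
        linarith
      · exact hok
    rcases hWs.eq_or_lt with hW0 | hWp
    · exact exit_W_EF m s a1 a2 u1 u2 hm ha1 ha2 hb1s hb2s hW0.symm hQs hHs'
    rcases min_eq_iff.mp hqs with ⟨hWz, _⟩ | ⟨hrest, _⟩
    · exact absurd hWz hWp.ne'
    rcases min_eq_iff.mp hrest with ⟨hQz, _⟩ | ⟨hrest2, _⟩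
    · exact exit_Q0_EF m s a1 a2 u1 u2 hm ha1 ha2 hb1s hb2s hWp hQs hHs' hBs hQz
    rcases min_eq_iff.mp hrest2 with ⟨hHz, _⟩ | ⟨hBz, _⟩
    · exact hExitH m s a1 a2 u1 u2 hm ha1 ha2 hb1s hb2s hWp hQs hHs' hBs (by linarith)
    · exact hExitH m s a1 a2 u1 u2 hm ha1 ha2 hb1s hb2s hWp hQs hHs' hBs (H_eq_zero_of_pB1_eq_zero m s a1 a2 u1 u2 hm ha1 ha2 hWp hQs hHs' hBz)
  -- continuity of the constraint (the big polynomials through their t-sliced forms, so that `fun_prop` sees low-degree polynomials in `s`; stated inline — the FF file owns the named lemmas)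
  have hcont : Continuous (fun s : ℝ => min (pW m s a1 a2) (min (pQ0 m s a1 a2 u1 u2) (min (-(pH m s a1 a2 u1 u2)) (pB1 m s a1 a2 u1 u2)))) := by
    have h2 : Continuous fun s : ℝ => pW m s a1 a2 := by simp only [pW_eq]; fun_prop
    have h3 : Continuous fun s : ℝ => pQ0 m s a1 a2 u1 u2 := by simp only [pQ0_eq]; fun_prop
    have hH : Continuous fun s : ℝ => pH m s a1 a2 u1 u2 := by simp only [pH_tpoly]; fun_prop
    have h4 : Continuous fun s : ℝ => -(pH m s a1 a2 u1 u2) := hH.neg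
    have h5 : Continuous fun s : ℝ => pB1 m s a1 a2 u1 u2 := by simp only [pB1_split]; fun_prop
    exact h2.min (h3.min (h4.min h5))
  have key := endpoint_principle (fun s : ℝ => pN m s a1 a2 u1 u2) (fun s : ℝ => (a1 + u1 - s) * (s - (u2 - a2))) (fun s : ℝ => min (pW m s a1 a2) (min (pQ0 m s a1 a2 u1 u2) (min (-(pH m s a1 a2 u1 u2)) (pB1 m s a1 a2 u1 u2))))
      (-(1:ℝ)*m^(2:ℕ)*a2*u2^(2:ℕ) - (1:ℝ)*m^(2:ℕ)*a1*u1^(2:ℕ)) (-(6:ℝ)*m*a2^(3:ℕ)*u2^(2:ℕ) + (3:ℝ)*m*a1*a2*u2^(3:ℕ) - (3:ℝ)*m*a1*a2*u1*u2^(2:ℕ) - (3:ℝ)*m*a1*a2*u1^(2:ℕ)*u2 + (3:ℝ)*m*a1*a2*u1^(3:ℕ) - (6:ℝ)*m*a1*a2^(2:ℕ)*u2^(2:ℕ) - (8:ℝ)*m*a1*a2^(2:ℕ)*u1*u2 + (2:ℝ)*m*a1*a2^(2:ℕ)*u1^(2:ℕ) - (2:ℝ)*m*a1^(2:ℕ)*a2*u2^(2:ℕ)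 - (4:ℝ)*m*a1^(2:ℕ)*a2*u1*u2 + (3:ℝ)*m^(2:ℕ)*a2*u2^(3:ℕ) - (6:ℝ)*m^(2:ℕ)*a2^(2:ℕ)*u2^(2:ℕ) + (3:ℝ)*m^(2:ℕ)*a1*u1^(3:ℕ) - (6:ℝ)*m^(2:ℕ)*a1*a2*u1*u2) ((6:ℝ)*a1*a2^(3:ℕ)*u2^(3:ℕ) - (18:ℝ)*a1*a2^(3:ℕ)*u1*u2^(2:ℕ) + (18:ℝ)*a1*a2^(3:ℕ)*u1^(2:ℕ)*u2 - (6:ℝ)*a1*a2^(3:ℕ)*u1^(3:ℕ) + (6:ℝ)*m*a2^(3:ℕ)*u2^(3:ℕ) + (24:ℝ)*m*a1*a2^(2:ℕ)*u1^(2:ℕ)*u2 - (12:ℝ)*m*a1*a2^(2:ℕ)*u1^(3:ℕ) + (12:ℝ)*m*a1*a2^(3:ℕ)*u2^(2:ℕ) - (12:ℝ)*m*a1*a2^(3:ℕ)*u1*u2 + (4:ℝ)*m*a1*a2^(3:ℕ)*u1^(2:ℕ) - (6:ℝ)*m*a1^(2:ℕ)*a2*u2^(3:ℕ) + (12:ℝ)*m*a1^(2:ℕ)*a2*u1*u2^(2:ℕ)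 + (12:ℝ)*m*a1^(2:ℕ)*a2^(2:ℕ)*u2^(2:ℕ) - (4:ℝ)*m*a1^(2:ℕ)*a2^(2:ℕ)*u1*u2 + (4:ℝ)*m*a1^(3:ℕ)*a2*u2^(2:ℕ) + (6:ℝ)*m^(2:ℕ)*a2^(3:ℕ)*u2^(2:ℕ) - (9:ℝ)*m^(2:ℕ)*a1*a2*u2^(3:ℕ) + (9:ℝ)*m^(2:ℕ)*a1*a2*u1*u2^(2:ℕ) + (9:ℝ)*m^(2:ℕ)*a1*a2*u1^(2:ℕ)*u2 - (9:ℝ)*m^(2:ℕ)*a1*a2*u1^(3:ℕ) + (18:ℝ)*m^(2:ℕ)*a1*a2^(2:ℕ)*u2^(2:ℕ) - (12:ℝ)*m^(2:ℕ)*a1*a2^(2:ℕ)*u1*u2 + (6:ℝ)*m^(2:ℕ)*a1*a2^(2:ℕ)*u1^(2:ℕ) + (6:ℝ)*m^(2:ℕ)*a1^(2:ℕ)*a2*u2^(2:ℕ) - (3:ℝ)*m^(3:ℕ)*a2*u2^(3:ℕ) + (6:ℝ)*m^(3:ℕ)*a2^(2:ℕ)*u2^(2:ℕ) - (3:ℝ)*m^(3:ℕ)*a1*u1^(3:ℕ)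 + (4:ℝ)*m^(3:ℕ)*a1*a2*u2^(2:ℕ) - (2:ℝ)*m^(3:ℕ)*a1*a2*u1*u2 + (4:ℝ)*m^(3:ℕ)*a1*a2*u1^(2:ℕ) + (1:ℝ)*m^(4:ℕ)*a2*u2^(2:ℕ) + (1:ℝ)*m^(4:ℕ)*a1*u1^(2:ℕ)) (a1 + u1 + (u2 - a2)) (-((a1 + u1) * (u2 - a2)))
      (by nlinarith [mul_nonneg (mul_nonneg (sq_nonneg m) ha2) (sq_nonneg u2), mul_nonneg (mul_nonneg (sq_nonneg m) ha1) (sq_nonneg u1)])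
      (fun s => pN_quadratic m s a1 a2 u1 u2)
      (fun s => by show (a1 + u1 - s) * (s - (u2 - a2)) = _; ring)
      hcont hP hQ' t (show (0:ℝ) ≤ (a1 + u1 - t) * (t - (u2 - a2)) from mul_nonneg (by linarith) (by linarith))
      (show (0:ℝ) ≤ min (pW m t a1 a2) (min (pQ0 m t a1 a2 u1 u2) (min (-(pH m t a1 a2 u1 u2)) (pB1 m t a1 a2 u1 u2))) from
        le_min hW.le (le_min hQ (le_min (neg_nonneg.mpr hH) hB)))
  exact key

end Summit.HodgeConjecture.HodgeConjecture.WeilClassTestFormatFiveThreeCrossPlusTwoPieceEFOfExitH
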